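import Mathlib.Analysis.SpecialFunctions.Pow.Real
import Mathlib.Algebra.Order.Chebyshev
import Mathlib.Algebra.BigOperators.Intervals
import HarnessLib

/-!
# van der Corput differencing with lags `d·R` for real sequences, and its bilinear form
# (Bourgain 2013, §2, (2.1)→(2.2)) — proved

Topic `Literature/NumberTheory/LFunctions`, a proofs companion of `MoebiusWalshCircuits.lean`
(named facts `bourgain_moebius_walsh_uniform`, `bourgain_liouville_walsh_uniform`: J. Bourgain,
*Möbius–Walsh correlation bounds and an estimate of Mauduit and Rivat*, J. Anal. Math. 119 (2013)
147–163 = arXiv:1109.2784, Theorem 1). Everything here is PROVED (theorems only; no definition,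
no named fact), and nothing is specific to Walsh functions: this is the generic first step of the
TYPE-II analysis of Bourgain's §2, which both named facts (for `μ` and for `λ`) go through with
the same box sums (`MoebiusWalshVaughan.abs_walshSum_moebius_le_boxes`,
`LiouvilleWalshVaughan.abs_walshSum_liouville_le_boxes`).

Bourgain, §2, (2.1)–(2.2): "Estimate `|∑_{m∼M} ∑_{n∼N} α_m β_n w_S(mn)| ≤ ∑_{m∼M} |∑_{n∼N} β_n w(mn)|`.
Fix `K` such that `L2^K < N` and write using Cauchy's inequality
`|∑_{n∼N} β_n w(mn)|² ≲ (N/L) ∑_{n∼N, |ℓ|<L} β_n β̄_{n+ℓ2^K} w(mn) w(m(n+ℓ2^K))`. Hence, by another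
application of Cauchy's inequality,
`(2.1)² ≲ (MN/L) ∑_{n∼N, |ℓ|<L} |∑_{m∼M} w_S(mn) w_S(m(n+ℓ2^K))|`  (2.2)."
This is the Weyl–van der Corput inequality with the lags restricted to the multiples `ℓ 2^K` of
`R = 2^K`, followed by the observation that after summing over `m` the coefficients factor out
and the `m`-sum lands innermost. We prove it with explicit constants, for real sequences on `ℕ`:

* `vdC_sq_sum_le` — for `f : ℕ → ℝ` vanishing outside `[B₀, B₀ + N)`, `H ≥ 1` lags `hR`
  (`(H-1)R ≤ B₀`, so that no shifted copy of the support is cut off at `0`):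
  `(∑_b f(b))² ≤ ((N + (H-1)R)/H²) ∑_{h,h'<H} ∑_b f(b + hR) f(b + h'R)`
  (`H ∑ f = ∑_b ∑_{h<H} f(b + hR)`, Cauchy–Schwarz over the `N + (H-1)R` relevant `b`, expand);
* `vdC_sq_sum_le_abs` — the same with the mixed correlations collected by lag `d = |h - h'|`
  (`vdC_kernel_shift_shift_eq`, `vdC_sum_sum_natAbs_le`):
  `(∑_b f(b))² ≤ (2(N + (H-1)R)/H) ∑_{d<H} |∑_b f(b + dR) f(b)|`
  (Graham–Kolesnik, *Van der Corput's method of exponential sums*, Lemma 2.5, has the sharper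
  weights `1, 2(1 - d/H)`; any form with `≍ N/H · ∑_{d<H}` suffices for Bourgain);
* `vdC_bilinear` — **the bilinear form (2.2)**: for a kernel `F : ℕ → ℕ → ℝ` (no size
  assumption), coefficients `|β| ≤ 1`, any finite set `A` of outer variables and inner range
  `[B₀, B₀ + N)`,
  `∑_{a∈A} (∑_b β_b F(a,b))² ≤ (2(N + (H-1)R)/H) ∑_{d<H} ∑_{b, b+dR ∈ [B₀,B₀+N)} |∑_{a∈A} F(a,b+dR) F(a,b)|`;
  with Cauchy–Schwarz `(∑_{a∈A} |S_a|)² ≤ |A| ∑_a S_a²` in front this is (2.2) with the constant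
  `2(N + (H-1)R)|A|/H ≤ 4MN/L` for `A = [M, 2M)`, `H = L`, `(L-1)2^K ≤ N = B₀`.

## References

* J. Bourgain, J. Anal. Math. 119 (2013) 147–163, §2, (2.1)–(2.2). [Bourgain2013MoebiusWalsh]
* S. W. Graham, G. Kolesnik, *Van der Corput's Method of Exponential Sums*, LMS Lecture Notes 126
  (1991), Lemma 2.5 (Weyl–van der Corput inequality).
-/

noncomputable section

open Finset

namespace Literature.NumberTheory.LFunctions.MoebiusWalsh

/-- Shifting a sum over `[0, U)` of a function supported in `[B₀, U)` by `s ≤ B₀` does not change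
it. [folklore] -/
theorem vdC_sum_range_shift_eq {F : ℕ → ℝ} {B₀ U s : ℕ} (hs : s ≤ B₀)
    (hlo : ∀ b, b < B₀ → F b = 0) (hhi : ∀ b, U ≤ b → F b = 0) :
    ∑ b ∈ range U, F (b + s) = ∑ b ∈ range U, F b := by
  rcases le_or_gt U s with hUs | hUs
  · -- everything vanishes
    have h1 : ∑ b ∈ range U, F (b + s) = 0 :=
      sum_eq_zero fun b _ => hhi _ (by omega)
    have h2 : ∑ b ∈ range U, F b = 0 :=
      sum_eq_zero fun b hb => hlo _ (by have := mem_range.mp hb; omega)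
    rw [h1, h2]
  rw [range_eq_Ico, sum_Ico_add' F 0 U s, zero_add]
  -- `∑_{Ico s (U+s)} F = ∑_{Ico s U} F + ∑_{Ico U (U+s)} F` and `∑_{Ico 0 U} F = ∑_{Ico 0 s} F + ∑_{Ico s U} F`
  rw [← sum_Ico_consecutive F hUs.le (Nat.le_add_right U s),
    ← sum_Ico_consecutive F (Nat.zero_le s) hUs.le]
  have h3 : ∑ b ∈ Ico U (U + s), F b = 0 :=
    sum_eq_zero fun b hb => hhi _ (mem_Ico.mp hb).1
  have h4 : ∑ b ∈ Ico 0 s, F b = 0 :=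
    sum_eq_zero fun b hb => hlo _ (by have := (mem_Ico.mp hb).2; omega)
  rw [h3, h4, add_zero, zero_add]

/-- **van der Corput differencing with lags multiple of `R`** (real sequences). Let `f : ℕ → ℝ`
vanish outside `[B₀, B₀ + N)`, `H ≥ 1`, `(H-1)R ≤ B₀`. Then
`(∑_{b < B₀+N} f(b))² ≤ ((N + (H-1)R)/H²) ∑_{h,h'<H} ∑_{b < B₀+N} f(b + hR) f(b + h'R)`.
[cite: Bourgain2013MoebiusWalsh, (2.1)–(2.2) ("write using Cauchy's inequality")] -/
theorem vdC_sq_sum_le {f : ℕ → ℝ} {B₀ N R H : ℕ} (hH : 0 < H) (hHR : (H - 1) * R ≤ B₀)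
    (hlo : ∀ b, b < B₀ → f b = 0) (hhi : ∀ b, B₀ + N ≤ b → f b = 0) :
    (∑ b ∈ range (B₀ + N), f b) ^ 2 ≤
      (((N : ℝ) + (H - 1 : ℕ) * R) / (H : ℝ) ^ 2) * ∑ h ∈ range H, ∑ h' ∈ range H,
        ∑ b ∈ range (B₀ + N), f (b + h * R) * f (b + h' * R) := by
  set U := B₀ + N with hU
  set S := ∑ b ∈ range U, f b with hS
  set g : ℕ → ℝ := fun b => ∑ h ∈ range H, f (b + h * R) with hg
  have hH0 : (0 : ℝ) < H := by exact_mod_cast hH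
  -- Step 1: `H S = ∑_b g(b)`
  have hshift : ∀ h ∈ range H, ∑ b ∈ range U, f (b + h * R) = S := by
    intro h hh
    have hh' := mem_range.mp hh
    refine vdC_sum_range_shift_eq (le_trans ?_ hHR) hlo hhi
    exact Nat.mul_le_mul_right _ (by omega)
  have hHS : (H : ℝ) * S = ∑ b ∈ range U, g b := by
    rw [hg]
    simp only
    rw [sum_comm, sum_congr rfl hshift, sum_const, card_range, nsmul_eq_mul]
  -- Step 2: `g` vanishes below `B₀ - (H-1)R`
  have hgvan : ∀ b, b + (H - 1) * R < B₀ → g b = 0 := by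
    intro b hb
    rw [hg]
    refine sum_eq_zero fun h hh => hlo _ ?_
    have hh' := mem_range.mp hh
    calc b + h * R ≤ b + (H - 1) * R := by
          refine Nat.add_le_add_left (Nat.mul_le_mul_right _ (by omega)) _
      _ < B₀ := hb
  set I := (range U).filter (fun b => B₀ ≤ b + (H - 1) * R) with hI
  have hsumI : ∑ b ∈ range U, g b = ∑ b ∈ I, g b := by
    rw [hI, sum_filter]
    refine sum_congr rfl fun b _ => ?_
    split_ifs with h
    · rfl
    · exact hgvan b (by omega)
  have hcardI : (I.card : ℝ) ≤ (N : ℝ) + (H - 1 : ℕ) * R := by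
    have hsub : I ⊆ Ico (B₀ - (H - 1) * R) U := by
      intro b hb
      rw [hI, mem_filter, mem_range] at hb
      rw [mem_Ico]; omega
    have := card_le_card hsub
    rw [Nat.card_Ico] at this
    have h2 : U - (B₀ - (H - 1) * R) ≤ N + (H - 1) * R := by omega
    exact_mod_cast this.trans h2
  -- Step 3: Cauchy–Schwarz on `I`
  have hCS : (∑ b ∈ I, g b) ^ 2 ≤ (I.card : ℝ) * ∑ b ∈ I, g b ^ 2 := by
    have := sum_mul_sq_le_sq_mul_sq I (fun _ => (1 : ℝ)) g
    simpa using this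
  have hsq_le : ∑ b ∈ I, g b ^ 2 ≤ ∑ b ∈ range U, g b ^ 2 :=
    sum_le_sum_of_subset_of_nonneg (filter_subset _ _) fun _ _ _ => sq_nonneg _
  -- Step 4: expand `∑_b g(b)²`
  have hexp : ∑ b ∈ range U, g b ^ 2 = ∑ h ∈ range H, ∑ h' ∈ range H,
      ∑ b ∈ range U, f (b + h * R) * f (b + h' * R) := by
    have hpt : ∀ b ∈ range U, g b ^ 2 =
        ∑ h ∈ range H, ∑ h' ∈ range H, f (b + h * R) * f (b + h' * R) := by
      intro b _
      simp only [hg]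
      rw [sq, sum_mul_sum]
    rw [sum_congr rfl hpt, sum_comm]
    refine sum_congr rfl fun h _ => ?_
    rw [sum_comm]
  -- assemble
  have hmain : ((H : ℝ) * S) ^ 2 ≤ ((N : ℝ) + (H - 1 : ℕ) * R) * ∑ b ∈ range U, g b ^ 2 := by
    rw [hHS, hsumI]
    refine hCS.trans ?_
    have hg2 : 0 ≤ ∑ b ∈ I, g b ^ 2 := sum_nonneg fun _ _ => sq_nonneg _
    calc (I.card : ℝ) * ∑ b ∈ I, g b ^ 2 ≤ ((N : ℝ) + (H - 1 : ℕ) * R) * ∑ b ∈ I, g b ^ 2 :=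
          mul_le_mul_of_nonneg_right hcardI hg2
      _ ≤ ((N : ℝ) + (H - 1 : ℕ) * R) * ∑ b ∈ range U, g b ^ 2 :=
          mul_le_mul_of_nonneg_left hsq_le (by positivity)
  rw [← hexp]
  rw [mul_pow] at hmain
  rw [div_mul_eq_mul_div, le_div_iff₀ (by positivity)]
  linarith

/-- A mixed correlation of a symmetric kernel vanishing when its second argument leaves
`[B₀, B₀+N)` is a pure correlation at lag `|h - h'| R` (shift the summation by `min(h,h') R ≤ B₀`).
[folklore] -/
theorem vdC_kernel_shift_shift_eq {P : ℕ → ℕ → ℝ} {B₀ N R H h h' : ℕ} (hh : h < H) (hh' : h' < H)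
    (hHR : (H - 1) * R ≤ B₀) (hsymm : ∀ x y, P x y = P y x)
    (hlo : ∀ x y, y < B₀ → P x y = 0) (hhi : ∀ x y, B₀ + N ≤ y → P x y = 0) :
    ∑ b ∈ range (B₀ + N), P (b + h * R) (b + h' * R) =
      ∑ b ∈ range (B₀ + N), P (b + (Int.natAbs (h - h' : ℤ)) * R) b := by
  wlog hle : h' ≤ h generalizing h h'
  · have := this hh' hh (le_of_not_ge hle)
    rw [show (h' : ℤ) - h = -((h : ℤ) - h') by ring, Int.natAbs_neg] at this
    rw [← this]
    exact sum_congr rfl fun b _ => hsymm _ _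
  have habs : Int.natAbs ((h : ℤ) - h') = h - h' := by omega
  rw [habs]
  have hs : h' * R ≤ B₀ := le_trans (Nat.mul_le_mul_right _ (by omega)) hHR
  have key := vdC_sum_range_shift_eq (F := fun b => P (b + (h - h') * R) b) (U := B₀ + N) hs
    (fun b hb => by simp [hlo _ b hb])
    (fun b hb => by simp [hhi _ b hb])
  rw [← key]
  refine sum_congr rfl fun b _ => ?_
  have e : b + h' * R + (h - h') * R = b + h * R := by
    rw [add_assoc, ← add_mul]; congr 2; omega
  show P (b + h * R) (b + h' * R) = P (b + h' * R + (h - h') * R) (b + h' * R)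
  rw [e]

/-- The mixed correlation `∑_b f(b + hR) f(b + h'R)` is the pure correlation at lag `|h - h'| R`.
[folklore] -/
theorem vdC_shift_mul_shift_eq {f : ℕ → ℝ} {B₀ N R H h h' : ℕ} (hh : h < H) (hh' : h' < H)
    (hHR : (H - 1) * R ≤ B₀) (hlo : ∀ b, b < B₀ → f b = 0) (hhi : ∀ b, B₀ + N ≤ b → f b = 0) :
    ∑ b ∈ range (B₀ + N), f (b + h * R) * f (b + h' * R) =
      ∑ b ∈ range (B₀ + N), f (b + (Int.natAbs (h - h' : ℤ)) * R) * f b :=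
  vdC_kernel_shift_shift_eq (P := fun x y => f x * f y) hh hh' hHR (fun x y => mul_comm _ _)
    (fun x y hy => by simp [hlo y hy]) (fun x y hy => by simp [hhi y hy])

/-- Summing a nonnegative function of `|h - h'|` over the square `h, h' < H`: every lag
`d < H` arises from at most `2H` pairs. [folklore] -/
theorem vdC_sum_sum_natAbs_le {a : ℕ → ℝ} (ha : ∀ d, 0 ≤ a d) (H : ℕ) :
    ∑ h ∈ range H, ∑ h' ∈ range H, a (Int.natAbs (h - h' : ℤ)) ≤
      2 * H * ∑ d ∈ range H, a d := by
  have hrow : ∀ h ∈ range H, ∑ h' ∈ range H, a (Int.natAbs (h - h' : ℤ)) ≤ 2 * ∑ d ∈ range H, a d := by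
    intro h hh
    have hh' := mem_range.mp hh
    rw [← sum_filter_add_sum_filter_not (range H) (fun h' => h' ≤ h)]
    have h1 : ∑ h' ∈ (range H).filter (fun h' => h' ≤ h), a (Int.natAbs (h - h' : ℤ)) ≤
        ∑ d ∈ range H, a d := by
      have hset : (range H).filter (fun h' => h' ≤ h) = range (h + 1) := by
        ext x; simp only [mem_filter, mem_range]; omega
      rw [hset]
      have h2 : ∑ h' ∈ range (h + 1), a (Int.natAbs (h - h' : ℤ)) =
          ∑ j ∈ range (h + 1), a (h + 1 - 1 - j) := by
        refine sum_congr rfl fun j hj => ?_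
        have := mem_range.mp hj
        congr 1; omega
      rw [h2, sum_range_reflect a (h + 1)]
      exact sum_le_sum_of_subset_of_nonneg (range_subset_range.mpr hh') fun _ _ _ => ha _
    have h2 : ∑ h' ∈ (range H).filter (fun h' => ¬ h' ≤ h), a (Int.natAbs (h - h' : ℤ)) ≤
        ∑ d ∈ range H, a d := by
      have hset : (range H).filter (fun h' => ¬ h' ≤ h) = Ico (h + 1) H := by
        ext x; simp only [mem_filter, mem_range, mem_Ico]; omega
      rw [hset, sum_Ico_eq_sum_range]
      have h3 : ∑ k ∈ range (H - (h + 1)), a (Int.natAbs (h - (h + 1 + k : ℕ) : ℤ)) =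
          ∑ k ∈ range (H - (h + 1)), a (k + 1) := by
        refine sum_congr rfl fun k _ => ?_
        congr 1; omega
      rw [h3]
      calc ∑ k ∈ range (H - (h + 1)), a (k + 1)
          = ∑ k ∈ Ico 1 (H - (h + 1) + 1), a k := by
            rw [sum_Ico_eq_sum_range]
            refine sum_congr (congrArg range (by omega)) fun k _ => by rw [add_comm]
        _ ≤ ∑ d ∈ range H, a d :=
            sum_le_sum_of_subset_of_nonneg (fun x hx => by
              rw [mem_Ico] at hx; rw [mem_range]; omega) fun _ _ _ => ha _
    linarith
  calc ∑ h ∈ range H, ∑ h' ∈ range H, a (Int.natAbs (h - h' : ℤ))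
      ≤ ∑ _h ∈ range H, 2 * ∑ d ∈ range H, a d := sum_le_sum hrow
    _ = 2 * H * ∑ d ∈ range H, a d := by
        rw [sum_const, card_range, nsmul_eq_mul]; ring

/-- **van der Corput with absolute correlations, lags multiple of `R`**: under the hypotheses of
`vdC_sq_sum_le`, `(∑_b f(b))² ≤ (2 (N + (H-1)R) / H) ∑_{d<H} |∑_b f(b + dR) f(b)|`
(Graham–Kolesnik Lemma 2.5 up to the weights). [cite: Bourgain2013MoebiusWalsh, (2.1)–(2.2)] -/
theorem vdC_sq_sum_le_abs {f : ℕ → ℝ} {B₀ N R H : ℕ} (hH : 0 < H) (hHR : (H - 1) * R ≤ B₀)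
    (hlo : ∀ b, b < B₀ → f b = 0) (hhi : ∀ b, B₀ + N ≤ b → f b = 0) :
    (∑ b ∈ range (B₀ + N), f b) ^ 2 ≤
      (2 * ((N : ℝ) + (H - 1 : ℕ) * R) / H) *
        ∑ d ∈ range H, |∑ b ∈ range (B₀ + N), f (b + d * R) * f b| := by
  have h1 := vdC_sq_sum_le hH hHR hlo hhi
  have hH0 : (0 : ℝ) < H := by exact_mod_cast hH
  have h2 : ∑ h ∈ range H, ∑ h' ∈ range H, ∑ b ∈ range (B₀ + N), f (b + h * R) * f (b + h' * R)
      ≤ 2 * H * ∑ d ∈ range H, |∑ b ∈ range (B₀ + N), f (b + d * R) * f b| := by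
    calc ∑ h ∈ range H, ∑ h' ∈ range H, ∑ b ∈ range (B₀ + N), f (b + h * R) * f (b + h' * R)
        = ∑ h ∈ range H, ∑ h' ∈ range H,
            ∑ b ∈ range (B₀ + N), f (b + (Int.natAbs (h - h' : ℤ)) * R) * f b := by
          refine sum_congr rfl fun h hh => sum_congr rfl fun h' hh' => ?_
          exact vdC_shift_mul_shift_eq (mem_range.mp hh) (mem_range.mp hh') hHR hlo hhi
      _ ≤ ∑ h ∈ range H, ∑ h' ∈ range H,
            |∑ b ∈ range (B₀ + N), f (b + (Int.natAbs (h - h' : ℤ)) * R) * f b| :=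
          sum_le_sum fun _ _ => sum_le_sum fun _ _ => le_abs_self _
      _ ≤ 2 * H * ∑ d ∈ range H, |∑ b ∈ range (B₀ + N), f (b + d * R) * f b| :=
          vdC_sum_sum_natAbs_le (a := fun d => |∑ b ∈ range (B₀ + N), f (b + d * R) * f b|)
            (fun _ => abs_nonneg _) H
  calc (∑ b ∈ range (B₀ + N), f b) ^ 2
      ≤ (((N : ℝ) + (H - 1 : ℕ) * R) / (H : ℝ) ^ 2) * (2 * H *
          ∑ d ∈ range H, |∑ b ∈ range (B₀ + N), f (b + d * R) * f b|) :=
        h1.trans (mul_le_mul_of_nonneg_left h2 (by positivity))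
    _ = (2 * ((N : ℝ) + (H - 1 : ℕ) * R) / H) *
          ∑ d ∈ range H, |∑ b ∈ range (B₀ + N), f (b + d * R) * f b| := by
        field_simp



/-- **Bilinear van der Corput (Bourgain 2013, (2.1)→(2.2))**: for a kernel `F : ℕ → ℕ → ℝ`,
coefficients `|β| ≤ 1`, a finite set `A` of outer variables, the inner range `[B₀, B₀ + N)` and
`H ≥ 1` lags multiple of `R` with `(H-1)R ≤ B₀`,
`∑_{a∈A} (∑_{b} β_b F(a,b))² ≤ (2(N + (H-1)R)/H) ∑_{d<H} ∑_{b, b+dR ∈ [B₀,B₀+N)} |∑_{a∈A} F(a,b+dR) F(a,b)|`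
— the coefficients are gone and the `a`-sum is innermost (van der Corput in `b` for each `a`,
then the sum over `a` of `f_a(b+hR) f_a(b+h'R) = β β' F F` factors).
[cite: Bourgain2013MoebiusWalsh, (2.2)] -/
theorem vdC_bilinear (F : ℕ → ℕ → ℝ) {β : ℕ → ℝ} (A : Finset ℕ) {B₀ N R H : ℕ} (hH : 0 < H)
    (hHR : (H - 1) * R ≤ B₀) (hβ : ∀ b, |β b| ≤ 1) :
    ∑ a ∈ A, (∑ b ∈ Ico B₀ (B₀ + N), β b * F a b) ^ 2 ≤
      (2 * ((N : ℝ) + (H - 1 : ℕ) * R) / H) *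
        ∑ d ∈ range H, ∑ b ∈ Ico B₀ (B₀ + N),
          (if b + d * R < B₀ + N then |∑ a ∈ A, F a (b + d * R) * F a b| else 0) := by
  set U := B₀ + N with hU
  have hH0 : (0 : ℝ) < H := by exact_mod_cast hH
  -- the truncated sequences
  let f : ℕ → ℕ → ℝ := fun a b => if B₀ ≤ b ∧ b < U then β b * F a b else 0
  have hflo : ∀ a b, b < B₀ → f a b = 0 := fun a b hb => by
    simp only [f]; rw [if_neg (by omega)]
  have hfhi : ∀ a b, U ≤ b → f a b = 0 := fun a b hb => by
    simp only [f]; rw [if_neg (by omega)]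
  have hS : ∀ a, ∑ b ∈ Ico B₀ U, β b * F a b = ∑ b ∈ range U, f a b := by
    intro a
    rw [range_eq_Ico, ← sum_Ico_consecutive _ (Nat.zero_le B₀) (Nat.le_add_right B₀ N)]
    have h0 : ∑ b ∈ Ico 0 B₀, f a b = 0 :=
      sum_eq_zero fun b hb => hflo a b (mem_Ico.mp hb).2
    rw [h0, zero_add]
    refine sum_congr rfl fun b hb => ?_
    rw [mem_Ico] at hb
    simp only [f]; rw [if_pos hb]
  -- the symmetric kernel
  let P : ℕ → ℕ → ℝ := fun x y =>
    if (B₀ ≤ x ∧ x < U) ∧ (B₀ ≤ y ∧ y < U) then |∑ a ∈ A, F a x * F a y| else 0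
  have hPsymm : ∀ x y, P x y = P y x := by
    intro x y
    simp only [P]
    have hsum : ∑ a ∈ A, F a x * F a y = ∑ a ∈ A, F a y * F a x :=
      sum_congr rfl fun a _ => mul_comm _ _
    by_cases hx : B₀ ≤ x ∧ x < U <;> by_cases hy : B₀ ≤ y ∧ y < U <;> simp [hx, hy, hsum]
  have hPlo : ∀ x y, y < B₀ → P x y = 0 := fun x y hy => by
    simp only [P]; rw [if_neg (by omega)]
  have hPhi : ∀ x y, U ≤ y → P x y = 0 := fun x y hy => by
    simp only [P]; rw [if_neg (by omega)]
  have hPnn : ∀ x y, 0 ≤ P x y := fun x y => by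
    simp only [P]; split_ifs
    · exact abs_nonneg _
    · exact le_rfl
  -- pointwise in `(h, h', b)`: the `a`-sum of the products of the truncated sequences is `≤ P`
  have hkey : ∀ x y, |∑ a ∈ A, f a x * f a y| ≤ P x y := by
    intro x y
    simp only [f, P]
    by_cases hx : B₀ ≤ x ∧ x < U
    · by_cases hy : B₀ ≤ y ∧ y < U
      · simp only [hx, hy, and_self, if_true]
        have : ∑ a ∈ A, β x * F a x * (β y * F a y) = β x * β y * ∑ a ∈ A, F a x * F a y := by
          rw [mul_sum]; exact sum_congr rfl fun a _ => by ring
        rw [this, abs_mul, abs_mul]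
        calc |β x| * |β y| * |∑ a ∈ A, F a x * F a y| ≤ 1 * 1 * |∑ a ∈ A, F a x * F a y| := by
              apply mul_le_mul_of_nonneg_right _ (abs_nonneg _)
              exact mul_le_mul (hβ x) (hβ y) (abs_nonneg _) zero_le_one
          _ = _ := by ring
      · simp [hy]
    · simp only [hx, if_false, zero_mul, sum_const_zero, abs_zero]
      split_ifs <;> first | exact abs_nonneg _ | exact le_rfl
  -- Step A: vdC for each `a`, summed
  have hA : ∑ a ∈ A, (∑ b ∈ range U, f a b) ^ 2 ≤
      (((N : ℝ) + (H - 1 : ℕ) * R) / (H : ℝ) ^ 2) * ∑ h ∈ range H, ∑ h' ∈ range H,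
        ∑ b ∈ range U, P (b + h * R) (b + h' * R) := by
    calc ∑ a ∈ A, (∑ b ∈ range U, f a b) ^ 2
        ≤ ∑ a ∈ A, (((N : ℝ) + (H - 1 : ℕ) * R) / (H : ℝ) ^ 2) * ∑ h ∈ range H, ∑ h' ∈ range H,
            ∑ b ∈ range U, f a (b + h * R) * f a (b + h' * R) :=
          sum_le_sum fun a _ => vdC_sq_sum_le hH hHR (hflo a) (hfhi a)
      _ = (((N : ℝ) + (H - 1 : ℕ) * R) / (H : ℝ) ^ 2) * ∑ h ∈ range H, ∑ h' ∈ range H,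
            ∑ b ∈ range U, ∑ a ∈ A, f a (b + h * R) * f a (b + h' * R) := by
          rw [← mul_sum]
          congr 1
          rw [sum_comm]
          refine sum_congr rfl fun h _ => ?_
          rw [sum_comm]
          refine sum_congr rfl fun h' _ => ?_
          rw [sum_comm]
      _ ≤ (((N : ℝ) + (H - 1 : ℕ) * R) / (H : ℝ) ^ 2) * ∑ h ∈ range H, ∑ h' ∈ range H,
            ∑ b ∈ range U, P (b + h * R) (b + h' * R) := by
          refine mul_le_mul_of_nonneg_left ?_ (by positivity)
          exact sum_le_sum fun h _ => sum_le_sum fun h' _ => sum_le_sum fun b _ =>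
            (le_abs_self _).trans (hkey _ _)
  -- Step B: symmetrise the lags
  have hB : ∑ h ∈ range H, ∑ h' ∈ range H, ∑ b ∈ range U, P (b + h * R) (b + h' * R) ≤
      2 * H * ∑ d ∈ range H, ∑ b ∈ range U, P (b + d * R) b := by
    calc ∑ h ∈ range H, ∑ h' ∈ range H, ∑ b ∈ range U, P (b + h * R) (b + h' * R)
        = ∑ h ∈ range H, ∑ h' ∈ range H, ∑ b ∈ range U, P (b + (Int.natAbs (h - h' : ℤ)) * R) b := by
          refine sum_congr rfl fun h hh => sum_congr rfl fun h' hh' => ?_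
          exact vdC_kernel_shift_shift_eq (mem_range.mp hh) (mem_range.mp hh') hHR hPsymm hPlo hPhi
      _ ≤ 2 * H * ∑ d ∈ range H, ∑ b ∈ range U, P (b + d * R) b :=
          vdC_sum_sum_natAbs_le (a := fun d => ∑ b ∈ range U, P (b + d * R) b)
            (fun d => sum_nonneg fun b _ => hPnn _ _) H
  -- Step C: identify the right-hand side
  have hC : ∀ d, ∑ b ∈ range U, P (b + d * R) b =
      ∑ b ∈ Ico B₀ U, (if b + d * R < U then |∑ a ∈ A, F a (b + d * R) * F a b| else 0) := by
    intro d
    rw [range_eq_Ico, ← sum_Ico_consecutive _ (Nat.zero_le B₀) (Nat.le_add_right B₀ N)]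
    have h0 : ∑ b ∈ Ico 0 B₀, P (b + d * R) b = 0 :=
      sum_eq_zero fun b hb => hPlo _ b (mem_Ico.mp hb).2
    rw [h0, zero_add]
    refine sum_congr rfl fun b hb => ?_
    rw [mem_Ico] at hb
    simp only [P]
    by_cases hd : b + d * R < U
    · rw [if_pos hd, if_pos ⟨⟨by omega, hd⟩, hb⟩]
    · rw [if_neg hd, if_neg (by omega)]
  -- assemble
  simp_rw [hS]
  refine hA.trans ?_
  simp_rw [← hC]
  calc (((N : ℝ) + (H - 1 : ℕ) * R) / (H : ℝ) ^ 2) * ∑ h ∈ range H, ∑ h' ∈ range H,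
        ∑ b ∈ range U, P (b + h * R) (b + h' * R)
      ≤ (((N : ℝ) + (H - 1 : ℕ) * R) / (H : ℝ) ^ 2) * (2 * H * ∑ d ∈ range H,
          ∑ b ∈ range U, P (b + d * R) b) := mul_le_mul_of_nonneg_left hB (by positivity)
    _ = (2 * ((N : ℝ) + (H - 1 : ℕ) * R) / H) * ∑ d ∈ range H, ∑ b ∈ range U, P (b + d * R) b := by
        have hH0' : (H : ℝ) ≠ 0 := hH0.ne'
        field_simp

end Literature.NumberTheory.LFunctions.MoebiusWalsh
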